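import Summits.QuantumFields.YangMills.Theorems.BalabanUVNodesN06Row17LocalClauseOnReg335OneLevel
import Literature.MathematicalPhysics.QuantumFieldTheory.Balaban1983to89.B9LocalLemma24TwoLevelCollarY

/-!
# BalabanUVNodes ∕ N06 ([B9], `Dag.B9_main`) — ROW 17's LOCAL CENTRE NUMBER `m_□` AND LOCAL CLAUSE AT AN INTERFACE ENLARGED CUBE `□̃(c)` FROM LEVEL GEOMETRY:
# the `hco` binder of the local road at `U = 1` for a TWO-LEVEL `cubeDomY x c` (levels `j, j+1`; no site of level `≥ j+2` two big-block steps around), and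
# `hloc(U)` on print's class (3.35) from L5's pencil letters — the interface-cube companions of `…LocalCentreOfLemma24Letter.coer_trIP_padDeltaALocY_one_cubeDomY_
# of_oneLevel_of_lev` and `…LocalClauseOnReg335OneLevel.posDefTr_padDeltaALocY_of_L5_of_regYP335_oneLevel`

Track A of `YM-PLAN.md` (cell `pub-ymgap`, HUMAN RULING D-0062), node **N06** = [Balaban1985BackgroundPropagators] Thms 3.1–3.15; seat `pub-ymgap-dag-n06-j`
(bundle F5, rows 15–17), g25.  A HELPER (count-neutral, `--supports` only).

THE PRINT.  [B9] p. 416 (proof of Thm 3.11): *«In [4] we have proved that the operator G_□(1) is positive»*; [4] = [Balaban1984PropagatorsII] (2.89) p. 239: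
*«We define B^j(Λ) = □̃ ∩ B^{j+1}(Λ_{j+1})»* (the cube meeting `Ω_{j+1}`), Lemma 2.4 (2.128) p. 245, (2.2)–(2.4) p. 224.

WHAT.  g24 closed the interface cube for dag-n10-c's DISPLAYED cube data (`…LocalCentreTwoLevel.coer_trIP_padDeltaALocY_one_of_twoLevel_letter`: block sets `S`, `T`,
`blockOf y ∉ T`, index facts `hIS`∕`hIB`, margins).  THIS FILE replaces the block sets and index facts by LEVEL GEOMETRY (this seat's Literature
`B9LocalLemma24TwoLevelCollarY.local_lemma24_real_twoLevel_of_lev`: `T` = the `Λ_{j+1}`-blocks inside `D` plus the COLLAR big blocks of (2.89)):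
* ★★★ `coer_trIP_padDeltaALocY_one_of_twoLevel_of_lev` — at def-Y's letters, for a block-saturated `D` whose sites have levels in `{j, j+1}` (`h2`), with no site of
  level `≥ j+2` under a big block two `(j+1)`-steps around a big block meeting `D` (`hNbr2`), label margins `hmargS`∕`hmargT`, weights `≥ w₀ > 0`, 0∕1 cuts with `χ`
  issuing from `D`: **`min 1 γ₂ · ⟨Ψ,Ψ⟩₁ ≤ ⟨Ψ, padDeltaALocY i parSymY parBY D (cutMulY χP) (cutMulY χ) 1 Ψ⟩₁` for EVERY `Ψ`**, `γ₂ = (2∕κ₂ + (4∕π)(1 + 4(d+1)c_f²∕κ₂))⁻¹`,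
  `κ₂ = (12(d+1)²(1 + 12(d+1)L^{2j}))⁻¹((L^{j+1})^{d+2})⁻¹·min(c_f²∕2, w₀∕(L^{j+1})^{d−1})`, `π = 8c_f²∕L^{2k}`.
* ★★★ `coer_trIP_padDeltaALocY_one_cubeDomY_of_twoLevel_of_lev` — AT W-a's `D := cubeDomY x c` (block-saturated by `B9LocalCubeGeometryOneLevelY.cubeDomY_dichotomy_lamSite`),
  `w₀ := b₀c_f²` (`B9DeltaAOneCoerciveOneLevelY.w_lower_of_globalBand`, `0 < b₀`): **the `hco` binder of the road of record at `U = 1` for an INTERFACE cube with an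
  explicit `m_□(d, L, j, c_f, b₀, k)`**, scope `h2 hNbr2 hmargS hmargT` in the level language of the one-level faces.
* ★★★ `posDefTr_padDeltaALocY_of_L5_of_regYP335_twoLevel` — `hloc(U)` on (3.35) at such a cube from L5's pencil letters, the fibre count, the radius inequalities at the
  explicit centre number and the (3.35) comparison (`…LocalClauseOnReg335OfL5Letters.posDefTr_padDeltaALocY_of_L5_of_regYP335` ∘ the above) — the `hco` binder GONE.
* §2 A CUBE-UNIFORM centre number per member: `kappa_twoLevel_antitone`, `gamma_twoLevel_antitone` (the constant is antitone in `j`), ★★★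
  `coer_trIP_padDeltaALocY_one_cubeDomY_of_twoLevel_unif` ∕ ★★★ `posDefTr_padDeltaALocY_of_L5_of_regYP335_twoLevel_unif` — the same faces with `m_□ = min 1 γ₂(k−1)`
  for EVERY cube whose levels lie in some window `{j, j+1}` (one radius inequality `hsmall` for all the cubes of a member).
HONEST FRAMING.  Compositions over landed files; the level facts `h2`, `hNbr2` ((2.2) near the cube) and the label margins (cubes off the torus chart's seam) are
DISPLAYED geometric facts; L5's analytic letters stay displayed; constants dag-n10-c's, LEVEL-DEPENDENT; COUNT-NEUTRAL; N06 ∕ N10 NOT discharged; nothing continuum ∕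
OS ∕ mass gap ∕ Clay.  0 `def`, 0 `sorry`.
-/

noncomputable section

namespace Summit.QuantumFields.YangMills.BalabanUVNodes.N06Row17LocalCentreTwoLevelOfLev

open Finset
open Literature.MathematicalPhysics.QuantumFieldTheory.Balaban1983to89
open Literature.MathematicalPhysics.QuantumFieldTheory.Balaban1983to89.Node00
open Literature.MathematicalPhysics.QuantumFieldTheory.Balaban1983to89.Node00.OpsYDeltaALocal (padDeltaALocY)
open Literature.MathematicalPhysics.QuantumFieldTheory.Balaban1983to89.B9Thm311ReadingCoords (trIP PosDefTr)
open Literature.MathematicalPhysics.QuantumFieldTheory.Balaban1983to89.B9Thm37CubeCoverCommutators (cutMulY)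
open Literature.MathematicalPhysics.QuantumFieldTheory.Balaban1983to89.B6KLevelCensusIndexV1 (KIdx kGeo)
open Literature.MathematicalPhysics.QuantumFieldTheory.Balaban1983to89.B6GlobalChartV1 (PV domT toBox boxEquiv)
open Literature.MathematicalPhysics.QuantumFieldTheory.Balaban1983to89.B5Eq118OneStroke (iterBlock iterBlockOf)
open Literature.MathematicalPhysics.QuantumFieldTheory.Balaban1983to89.B6SectALemma24OneLevelV1 (cornerV1)
open Literature.MathematicalPhysics.QuantumFieldTheory.Balaban1983to89.LatticeFieldCalculus (stairSum)
open Literature.MathematicalPhysics.QuantumFieldTheory.Balaban1983to89.Node00.OpsYNablaBridge (chartY)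
open Literature.MathematicalPhysics.QuantumFieldTheory.Balaban1983to89.B9BackgroundsKLevelV1 (CfgV1)
open Literature.MathematicalPhysics.QuantumFieldTheory.Balaban1983to89.B9BackgroundsKLevelV1P (bg9YP)
open Literature.MathematicalPhysics.QuantumFieldTheory.Balaban1983to89.B9PinMembersKLevelV1 (MemberY)
open Literature.MathematicalPhysics.QuantumFieldTheory.Balaban1983to89.B6Cover236MultiLevelBlocks (cubes)
open Literature.MathematicalPhysics.QuantumFieldTheory.Balaban1983to89.B9WalkLettersCoordsS (cubeDomY)
open Literature.MathematicalPhysics.QuantumFieldTheory.Balaban1983to89.LatticeNorms (scaleLen)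
open Literature.MathematicalPhysics.QuantumFieldTheory.Balaban1983to89.B5TorusCover (UT)
open Literature.MathematicalPhysics.QuantumFieldTheory.Balaban1983to89.B13EntrywiseWalks (RawEntryLetters)
open Literature.MathematicalPhysics.QuantumFieldTheory.Balaban1983to89.B9Eq39Adjoint (prodCfg)
open Literature.MathematicalPhysics.QuantumFieldTheory.Balaban1983to89.B9LocalCubeGeometryOneLevelY (cubeDomY_dichotomy_lamSite chartY_eq_toBox)
open Literature.MathematicalPhysics.QuantumFieldTheory.Balaban1983to89.B9DeltaAOneCoerciveOneLevelY (w_lower_of_globalBand)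
open Literature.MathematicalPhysics.QuantumFieldTheory.Balaban1983to89.B9LocalLemma24TwoLevelAtLettersY (local_lemma24_twoLevel_const_pos)
open Literature.MathematicalPhysics.QuantumFieldTheory.Balaban1983to89.B9LocalLemma24TwoLevelCollarY (local_lemma24_real_twoLevel_of_lev)
open Summit.QuantumFields.YangMills.BalabanUVNodes.N06Row17LocalCentreOfLemma24 (coer_trIP_padDeltaALocY_one_of_lemma24_letter)
open Summit.QuantumFields.YangMills.BalabanUVNodes.N06Row17LocalClauseOnReg335OfL5 (posDefTr_padDeltaALocY_of_L5_of_regYP335)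
open Literature.MathematicalPhysics.QuantumFieldTheory.Balaban1983to89.B9Thm311DeltaPrimePos (trIP_self_nonneg)
open scoped Matrix
open scoped Matrix.Norms.L2Operator

variable {N : ℕ} {d ℓ : ℕ} {hd : 1 ≤ d + 1} {hL : Odd (ℓ + 1) ∧ 1 < ℓ + 1} {b₀ b₁ : ℝ} {Mstar : ℕ}
variable {ν : ℕ} {Nf : Fin ν → ℕ} [∀ j, NeZero (Nf j)]

/-- ★★★ **ROW 17's LOCAL CENTRE NUMBER AT A TWO-LEVEL SITE SET FROM LEVEL GEOMETRY, `U = 1`.**  At def-Y's letters, `j + 1 ≤ k`, for a block-saturated `D` (`hD`)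
whose fine sites have levels in `{j, j+1}` (`h2`), with no site of level `≥ j+2` under a big block two `(j+1)`-steps around a big block meeting `D` (`hNbr2`), the
label margins `hmargS`∕`hmargT`, weights `≥ w₀ > 0`, 0∕1 cuts `χP`, `χ` with `χ` issuing from `D`:
**`min 1 γ₂ · ⟨Ψ,Ψ⟩₁ ≤ ⟨Ψ, padDeltaALocY i parSymY parBY D (cutMulY χP) (cutMulY χ) 1 Ψ⟩₁` for every `Ψ`** — `coer_trIP_padDeltaALocY_one_of_lemma24_letter` ∘
`local_lemma24_real_twoLevel_of_lev`. [cite: Balaban1985BackgroundPropagators, Thm 3.11 proof p.416, Cor. 3.6 p.408, pp.408–409; Balaban1984PropagatorsII, (2.89) p.239, Lemma 2.4 (2.128) p.245, (2.2)–(2.4) p.224, (2.11) p.225] -/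
theorem coer_trIP_padDeltaALocY_one_of_twoLevel_of_lev (i : KIdx d ℓ hd hL b₀ b₁) (hd2 : 2 ≤ d + 1) {j : ℕ} (hjk : j + 1 ≤ i.k) (D : Finset (SiteY i))
    (hD : ∀ (j' : ℕ) (y : Site (PV d ℓ i.m i.K hd hL) j'), (domT i.hN i.D i.hk).LamSite j' y →
      (∀ x ∈ iterBlock j' y, chartY i x ∈ D) ∨ (∀ x ∈ iterBlock j' y, chartY i x ∉ D))
    (h2 : ∀ x : Site (PV d ℓ i.m i.K hd hL) 0, chartY i x ∈ D →
      i.D.lev (toBox i.hN x : Fin (d + 1) → ℤ) = j ∨ i.D.lev (toBox i.hN x : Fin (d + 1) → ℤ) = j + 1)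
    (hNbr2 : ∀ Y₀ Y₁ Y₂ : Site (PV d ℓ i.m i.K hd hL) (j + 1),
      (∃ x : Site (PV d ℓ i.m i.K hd hL) 0, iterBlockOf (j + 1) x = Y₀ ∧ chartY i x ∈ D) →
      (Y₁ = Y₀ ∨ ∃ μ, Y₁ = Y₀.shift μ ∨ Y₀ = Y₁.shift μ) → (Y₂ = Y₁ ∨ ∃ μ, Y₂ = Y₁.shift μ ∨ Y₁ = Y₂.shift μ) →
      ∀ y : Site (PV d ℓ i.m i.K hd hL) 0, iterBlockOf (j + 1) y = Y₂ → i.D.lev (toBox i.hN y : Fin (d + 1) → ℤ) ≤ j + 1)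
    (hmargS : ∀ y : Site (PV d ℓ i.m i.K hd hL) j, (domT i.hN i.D i.hk).LamSite j y → (∃ x ∈ iterBlock j y, chartY i x ∈ D) →
      ∀ μ, (ℓ + 1) ^ (j + 1) ≤ (y μ).val * (ℓ + 1) ^ j ∧ (y μ).val * (ℓ + 1) ^ j + (ℓ + 1) ^ j + (ℓ + 1) ^ (j + 1) ≤ (PV d ℓ i.m i.K hd hL).sitesPerDir 0)
    (hmargT : ∀ Y : Site (PV d ℓ i.m i.K hd hL) (j + 1), (domT i.hN i.D i.hk).LamSite (j + 1) Y →
      (∃ Y₀ : Site (PV d ℓ i.m i.K hd hL) (j + 1), (∃ x : Site (PV d ℓ i.m i.K hd hL) 0, iterBlockOf (j + 1) x = Y₀ ∧ chartY i x ∈ D) ∧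
        (Y = Y₀ ∨ ∃ μ, Y = Y₀.shift μ ∨ Y₀ = Y.shift μ)) →
      ∀ μ, (ℓ + 1) ^ (j + 1) ≤ (Y μ).val * (ℓ + 1) ^ (j + 1) ∧ (Y μ).val * (ℓ + 1) ^ (j + 1) + 2 * (ℓ + 1) ^ (j + 1) ≤ (PV d ℓ i.m i.K hd hL).sitesPerDir 0)
    {w₀ : ℝ} (hw₀ : 0 < w₀) (hw : ∀ ι : IBondY i, w₀ ≤ i.w ι)
    {χP : BlkY i → ℝ} (hχP : ∀ y, χP y = 0 ∨ χP y = 1) {χ : FBondY i → ℝ} (hχ : ∀ b, χ b = 0 ∨ χ b = 1)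
    (hχD : ∀ b, χ b ≠ 0 → chartY i b.src ∈ D) (Ψ : FBondY i → Matrix (Fin N) (Fin N) ℂ) :
    min 1 (2 / ((12 * (((d + 1 : ℕ) : ℝ)) ^ 2 * (1 + 12 * (((d + 1 : ℕ) : ℝ)) * ((((ℓ + 1 : ℕ) : ℝ)) ^ j) ^ 2))⁻¹ *
              (((((ℓ + 1 : ℕ) : ℝ)) ^ (j + 1)) ^ (d + 1 + 1))⁻¹ * min (i.cf ^ 2 / 2) (w₀ / ((((ℓ + 1 : ℕ) : ℝ)) ^ (j + 1)) ^ (d + 1 - 2))) +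
          4 / (8 * i.cf ^ 2 / ((((ℓ + 1 : ℕ) : ℝ)) ^ i.k) ^ 2) *
            (1 + 4 * ((d + 1 : ℕ) : ℝ) * i.cf ^ 2 /
              ((12 * (((d + 1 : ℕ) : ℝ)) ^ 2 * (1 + 12 * (((d + 1 : ℕ) : ℝ)) * ((((ℓ + 1 : ℕ) : ℝ)) ^ j) ^ 2))⁻¹ *
                (((((ℓ + 1 : ℕ) : ℝ)) ^ (j + 1)) ^ (d + 1 + 1))⁻¹ * min (i.cf ^ 2 / 2) (w₀ / ((((ℓ + 1 : ℕ) : ℝ)) ^ (j + 1)) ^ (d + 1 - 2)))))⁻¹ *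
        trIP (fun _ => (1 : ℝ)) Ψ Ψ ≤
      trIP (fun _ => (1 : ℝ)) Ψ
        (padDeltaALocY i (parSymY i) (parBY i) D (cutMulY χP) (cutMulY χ) (fun _ _ => 1 : CfgY (Matrix (Fin N) (Fin N) ℂ) i) Ψ) :=
  coer_trIP_padDeltaALocY_one_of_lemma24_letter i D hD hχP hχ hχD (local_lemma24_twoLevel_const_pos i j hw₀)
    (fun v hst hoff => local_lemma24_real_twoLevel_of_lev i hd2 hjk D hD h2 hNbr2 hmargS hmargT hw₀ hw v hst hoff) Ψ

/-- ★★★ **ROW 17's LOCAL CENTRE NUMBER AT W-a's `□̃(c)`, `U = 1`, FOR AN INTERFACE (TWO-LEVEL) ENLARGED CUBE.**  For a member `x`, a cover cube `c` whose enlarged cube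
`□̃(c) = cubeDomY x c` meets member blocks of the levels `j`, `j+1` only (`h2`, `j + 1 ≤ k`), such that no fine site of level `≥ j+2` lies under a big block two
`(j+1)`-steps around a big block meeting `□̃(c)` (`hNbr2`), with the label margins of one big block off the box boundary (`hmargS`, `hmargT`), `0 < b₀`, and 0∕1 cuts `χP`,
`χ` with `χ` issuing from `□̃(c)`: **`min 1 γ₂ · ⟨Ψ,Ψ⟩₁ ≤ ⟨Ψ, padDeltaALocY x.toKIdx parSymY parBY (cubeDomY x c) (cutMulY χP) (cutMulY χ) 1 Ψ⟩₁` for EVERY `Ψ`** with the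
explicit `γ₂ = γ₂(κ₂(c_f, b₀c_f²), π(c_f, k))` — the `hco` binder of the road of record at `U = 1` for the cubes of (2.89).
[cite: Balaban1985BackgroundPropagators, Thm 3.11 proof p.416, Cor. 3.6 p.408, pp.408–409 (G_□, □̃); Balaban1984PropagatorsII, (2.89) p.239, Lemma 2.4 (2.128) p.245, (2.2)–(2.4) p.224, (2.16) p.225] -/
theorem coer_trIP_padDeltaALocY_one_cubeDomY_of_twoLevel_of_lev (x : MemberY d ℓ hd hL b₀ b₁ Mstar) (c : ↥(cubes x.toKIdx.D.toDomains))
    (hd2 : 2 ≤ d + 1) {j : ℕ} (hjk : j + 1 ≤ x.toKIdx.k)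
    (h2 : ∀ z ∈ cubeDomY x c, x.toKIdx.D.lev z.1 = j ∨ x.toKIdx.D.lev z.1 = j + 1)
    (hNbr2 : ∀ Y₀ Y₁ Y₂ : Site (PV d ℓ x.m x.K hd hL) (j + 1),
      (∃ y : Site (PV d ℓ x.m x.K hd hL) 0, iterBlockOf (j + 1) y = Y₀ ∧ chartY x.toKIdx y ∈ cubeDomY x c) →
      (Y₁ = Y₀ ∨ ∃ μ, Y₁ = Y₀.shift μ ∨ Y₀ = Y₁.shift μ) → (Y₂ = Y₁ ∨ ∃ μ, Y₂ = Y₁.shift μ ∨ Y₁ = Y₂.shift μ) →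
      ∀ y : Site (PV d ℓ x.m x.K hd hL) 0, iterBlockOf (j + 1) y = Y₂ → x.toKIdx.D.lev (toBox x.toKIdx.hN y : Fin (d + 1) → ℤ) ≤ j + 1)
    (hmargS : ∀ y : Site (PV d ℓ x.m x.K hd hL) j, (domT x.toKIdx.hN x.toKIdx.D x.toKIdx.hk).LamSite j y →
      (∃ y' ∈ iterBlock j y, chartY x.toKIdx y' ∈ cubeDomY x c) →
      ∀ μ, (ℓ + 1) ^ (j + 1) ≤ (y μ).val * (ℓ + 1) ^ j ∧ (y μ).val * (ℓ + 1) ^ j + (ℓ + 1) ^ j + (ℓ + 1) ^ (j + 1) ≤ (PV d ℓ x.m x.K hd hL).sitesPerDir 0)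
    (hmargT : ∀ Y : Site (PV d ℓ x.m x.K hd hL) (j + 1), (domT x.toKIdx.hN x.toKIdx.D x.toKIdx.hk).LamSite (j + 1) Y →
      (∃ Y₀ : Site (PV d ℓ x.m x.K hd hL) (j + 1), (∃ y : Site (PV d ℓ x.m x.K hd hL) 0, iterBlockOf (j + 1) y = Y₀ ∧ chartY x.toKIdx y ∈ cubeDomY x c) ∧
        (Y = Y₀ ∨ ∃ μ, Y = Y₀.shift μ ∨ Y₀ = Y.shift μ)) →
      ∀ μ, (ℓ + 1) ^ (j + 1) ≤ (Y μ).val * (ℓ + 1) ^ (j + 1) ∧ (Y μ).val * (ℓ + 1) ^ (j + 1) + 2 * (ℓ + 1) ^ (j + 1) ≤ (PV d ℓ x.m x.K hd hL).sitesPerDir 0)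
    (hb₀ : 0 < b₀) {χP : BlkY x.toKIdx → ℝ} (hχP : ∀ y, χP y = 0 ∨ χP y = 1) {χ : FBondY x.toKIdx → ℝ} (hχ : ∀ b, χ b = 0 ∨ χ b = 1)
    (hχD : ∀ b, χ b ≠ 0 → chartY x.toKIdx b.src ∈ cubeDomY x c) (Ψ : FBondY x.toKIdx → Matrix (Fin N) (Fin N) ℂ) :
    min 1 (2 / ((12 * (((d + 1 : ℕ) : ℝ)) ^ 2 * (1 + 12 * (((d + 1 : ℕ) : ℝ)) * ((((ℓ + 1 : ℕ) : ℝ)) ^ j) ^ 2))⁻¹ *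
              (((((ℓ + 1 : ℕ) : ℝ)) ^ (j + 1)) ^ (d + 1 + 1))⁻¹ *
                min (x.toKIdx.cf ^ 2 / 2) (b₀ * x.toKIdx.cf ^ 2 / ((((ℓ + 1 : ℕ) : ℝ)) ^ (j + 1)) ^ (d + 1 - 2))) +
          4 / (8 * x.toKIdx.cf ^ 2 / ((((ℓ + 1 : ℕ) : ℝ)) ^ x.toKIdx.k) ^ 2) *
            (1 + 4 * ((d + 1 : ℕ) : ℝ) * x.toKIdx.cf ^ 2 /
              ((12 * (((d + 1 : ℕ) : ℝ)) ^ 2 * (1 + 12 * (((d + 1 : ℕ) : ℝ)) * ((((ℓ + 1 : ℕ) : ℝ)) ^ j) ^ 2))⁻¹ *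
                (((((ℓ + 1 : ℕ) : ℝ)) ^ (j + 1)) ^ (d + 1 + 1))⁻¹ *
                  min (x.toKIdx.cf ^ 2 / 2) (b₀ * x.toKIdx.cf ^ 2 / ((((ℓ + 1 : ℕ) : ℝ)) ^ (j + 1)) ^ (d + 1 - 2)))))⁻¹ *
        trIP (fun _ => (1 : ℝ)) Ψ Ψ ≤
      trIP (fun _ => (1 : ℝ)) Ψ
        (padDeltaALocY x.toKIdx (parSymY x.toKIdx) (parBY x.toKIdx) (cubeDomY x c) (cutMulY χP) (cutMulY χ)
          (fun _ _ => 1 : CfgY (Matrix (Fin N) (Fin N) ℂ) x.toKIdx) Ψ) :=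
  coer_trIP_padDeltaALocY_one_of_twoLevel_of_lev x.toKIdx hd2 hjk (cubeDomY x c) (cubeDomY_dichotomy_lamSite x c)
    (fun y hy => h2 _ (by rw [chartY_eq_toBox] at hy; exact hy)) hNbr2 hmargS hmargT (mul_pos hb₀ (sq_pos_iff.mpr x.toKIdx.hcf))
    (fun ι => w_lower_of_globalBand x.toKIdx hd2 hb₀.le ι) hχP hχ hχD Ψ

/-- ★★★ **ROW 17's LOCAL CLAUSE ON (3.35) AT AN INTERFACE `□̃(c)`, CENTRE NUMBER BUILT IN**: `hloc(U)` for `U` in print's class from L5's pencil letters `hA`, the fibre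
count `hfib`, the radius inequalities `hR′ hR′R`, `hsmall` at the EXPLICIT two-level centre number `m_□ = min 1 γ₂`, and the (3.35) comparison `hCr` — for an enlarged cube
meeting member blocks of the levels `j`, `j+1` only, no site of level `≥ j+2` two big-block steps around it, margins off the box boundary, 0∕1 cuts with `χ` issuing from
`□̃(c)`, `0 < b₀`. [cite: Balaban1985BackgroundPropagators, Thm 3.11 proof p.416, Cor. 3.6 p.408, (3.35) p.396, pp.408–410; Balaban1984PropagatorsII, (2.89) p.239, p.226, Lemma 2.4 (2.128) p.245; Balaban1988RG2Cluster, p.15] -/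
theorem posDefTr_padDeltaALocY_of_L5_of_regYP335_twoLevel [Nonempty (Fin N)] {G : Subgroup (Matrix (Fin N) (Fin N) ℂ)ˣ}
    (x : MemberY d ℓ hd hL b₀ b₁ Mstar) (c : ↥(cubes x.toKIdx.D.toDomains)) {χP : BlkY x.toKIdx → ℝ} (hχP : ∀ y, χP y = 0 ∨ χP y = 1)
    {χ : FBondY x.toKIdx → ℝ} (hχ : ∀ b, χ b = 0 ∨ χ b = 1) (hχD : ∀ b, χ b ≠ 0 → boxEquiv x.toKIdx.hN b.src ∈ cubeDomY x c)
    (hd2 : 2 ≤ d + 1) {j : ℕ} (hjk : j + 1 ≤ x.toKIdx.k)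
    (h2 : ∀ z ∈ cubeDomY x c, x.toKIdx.D.lev z.1 = j ∨ x.toKIdx.D.lev z.1 = j + 1)
    (hNbr2 : ∀ Y₀ Y₁ Y₂ : Site (PV d ℓ x.m x.K hd hL) (j + 1),
      (∃ y : Site (PV d ℓ x.m x.K hd hL) 0, iterBlockOf (j + 1) y = Y₀ ∧ chartY x.toKIdx y ∈ cubeDomY x c) →
      (Y₁ = Y₀ ∨ ∃ μ, Y₁ = Y₀.shift μ ∨ Y₀ = Y₁.shift μ) → (Y₂ = Y₁ ∨ ∃ μ, Y₂ = Y₁.shift μ ∨ Y₁ = Y₂.shift μ) →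
      ∀ y : Site (PV d ℓ x.m x.K hd hL) 0, iterBlockOf (j + 1) y = Y₂ → x.toKIdx.D.lev (toBox x.toKIdx.hN y : Fin (d + 1) → ℤ) ≤ j + 1)
    (hmargS : ∀ y : Site (PV d ℓ x.m x.K hd hL) j, (domT x.toKIdx.hN x.toKIdx.D x.toKIdx.hk).LamSite j y →
      (∃ y' ∈ iterBlock j y, chartY x.toKIdx y' ∈ cubeDomY x c) →
      ∀ μ, (ℓ + 1) ^ (j + 1) ≤ (y μ).val * (ℓ + 1) ^ j ∧ (y μ).val * (ℓ + 1) ^ j + (ℓ + 1) ^ j + (ℓ + 1) ^ (j + 1) ≤ (PV d ℓ x.m x.K hd hL).sitesPerDir 0)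
    (hmargT : ∀ Y : Site (PV d ℓ x.m x.K hd hL) (j + 1), (domT x.toKIdx.hN x.toKIdx.D x.toKIdx.hk).LamSite (j + 1) Y →
      (∃ Y₀ : Site (PV d ℓ x.m x.K hd hL) (j + 1), (∃ y : Site (PV d ℓ x.m x.K hd hL) 0, iterBlockOf (j + 1) y = Y₀ ∧ chartY x.toKIdx y ∈ cubeDomY x c) ∧
        (Y = Y₀ ∨ ∃ μ, Y = Y₀.shift μ ∨ Y₀ = Y.shift μ)) →
      ∀ μ, (ℓ + 1) ^ (j + 1) ≤ (Y μ).val * (ℓ + 1) ^ (j + 1) ∧ (Y μ).val * (ℓ + 1) ^ (j + 1) + 2 * (ℓ + 1) ^ (j + 1) ≤ (PV d ℓ x.m x.K hd hL).sitesPerDir 0)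
    (hb₀ : 0 < b₀)
    {cthr α₀ : ℝ} (hc : cthr ≤ 10) (hα : 0 ≤ α₀) {U : CfgV1 (PV d ℓ x.m x.K hd hL) (Matrix (Fin N) (Fin N) ℂ)}
    (hreg : (bg9YP (Matrix (Fin N) (Fin N) ℂ) G x).Reg335 cthr α₀ U)
    {loc : FBondY x.toKIdx × (Fin N × Fin N) → UT Nf} {R R' ρ B : ℝ}
    (hA : RawEntryLetters (fun a : Fin (d + 1) → Site (PV d ℓ x.m x.K hd hL) 0 → Matrix (Fin N) (Fin N) ℂ =>
      LinearMap.toMatrix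
        ((Pi.basis fun _ : FBondY x.toKIdx => Matrix.stdBasis ℂ (Fin N) (Fin N)).reindex (Equiv.sigmaEquivProd (FBondY x.toKIdx) (Fin N × Fin N)))
        ((Pi.basis fun _ : FBondY x.toKIdx => Matrix.stdBasis ℂ (Fin N) (Fin N)).reindex (Equiv.sigmaEquivProd (FBondY x.toKIdx) (Fin N × Fin N)))
        (padDeltaALocY x.toKIdx (parSymY x.toKIdx) (parBY x.toKIdx) (cubeDomY x c) (cutMulY χP) (cutMulY χ)
          (prodCfg (1 : CfgY (Matrix (Fin N) (Fin N) ℂ) x.toKIdx) (kGeo x.toKIdx).eta a))) loc R ρ B)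
    (hρ : 0 < ρ) {mF : ℕ} (hfib : ∀ y : UT Nf, (univ.filter fun k => loc k = y).card ≤ mF)
    (hR' : 0 < R') (hR'R : R' ≤ R)
    (hsmall : 2 * (B * (mF * B6.c0 1 ρ ^ ν)) * R' <
      min 1 (2 / ((12 * (((d + 1 : ℕ) : ℝ)) ^ 2 * (1 + 12 * (((d + 1 : ℕ) : ℝ)) * ((((ℓ + 1 : ℕ) : ℝ)) ^ j) ^ 2))⁻¹ *
                (((((ℓ + 1 : ℕ) : ℝ)) ^ (j + 1)) ^ (d + 1 + 1))⁻¹ *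
                  min (x.toKIdx.cf ^ 2 / 2) (b₀ * x.toKIdx.cf ^ 2 / ((((ℓ + 1 : ℕ) : ℝ)) ^ (j + 1)) ^ (d + 1 - 2))) +
            4 / (8 * x.toKIdx.cf ^ 2 / ((((ℓ + 1 : ℕ) : ℝ)) ^ x.toKIdx.k) ^ 2) *
              (1 + 4 * ((d + 1 : ℕ) : ℝ) * x.toKIdx.cf ^ 2 /
                ((12 * (((d + 1 : ℕ) : ℝ)) ^ 2 * (1 + 12 * (((d + 1 : ℕ) : ℝ)) * ((((ℓ + 1 : ℕ) : ℝ)) ^ j) ^ 2))⁻¹ *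
                  (((((ℓ + 1 : ℕ) : ℝ)) ^ (j + 1)) ^ (d + 1 + 1))⁻¹ *
                    min (x.toKIdx.cf ^ 2 / 2) (b₀ * x.toKIdx.cf ^ 2 / ((((ℓ + 1 : ℕ) : ℝ)) ^ (j + 1)) ^ (d + 1 - 2)))))⁻¹ * R)
    (hCr : 2 * (kGeo x.toKIdx).L ^ 4 * ((kGeo x.toKIdx).M * α₀) * (scaleLen (kGeo x.toKIdx).L (kGeo x.toKIdx).eta c.1.1)⁻¹ ≤ R') :
    PosDefTr (fun _ => (1 : ℝ)) (padDeltaALocY x.toKIdx (parSymY x.toKIdx) (parBY x.toKIdx) (cubeDomY x c) (cutMulY χP) (cutMulY χ) U) :=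
  posDefTr_padDeltaALocY_of_L5_of_regYP335 x c χP hχD hc hα hreg hA hρ hfib
    (coer_trIP_padDeltaALocY_one_cubeDomY_of_twoLevel_of_lev x c hd2 hjk h2 hNbr2 hmargS hmargT hb₀ hχP hχ hχD) hR' hR'R hsmall hCr


/-! ## §2 A CUBE-UNIFORM centre number per member: the two-level constant is antitone in the level, so `j := k − 1` serves every cube -/

/-- the two-level Lemma-2.4 constant `κ₂(j)` is ANTITONE in the level `j` (`L ≥ 1`). [cite: Balaban1984PropagatorsII, Lemma 2.4 (2.128) p.245; folklore] -/
theorem kappa_twoLevel_antitone (i : KIdx d ℓ hd hL b₀ b₁) {w₀ : ℝ} (hw₀ : 0 ≤ w₀) {j j' : ℕ} (hjj : j ≤ j') :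
    (12 * (((d + 1 : ℕ) : ℝ)) ^ 2 * (1 + 12 * (((d + 1 : ℕ) : ℝ)) * ((((ℓ + 1 : ℕ) : ℝ)) ^ j') ^ 2))⁻¹ *
        (((((ℓ + 1 : ℕ) : ℝ)) ^ (j' + 1)) ^ (d + 1 + 1))⁻¹ * min (i.cf ^ 2 / 2) (w₀ / ((((ℓ + 1 : ℕ) : ℝ)) ^ (j' + 1)) ^ (d + 1 - 2)) ≤
      (12 * (((d + 1 : ℕ) : ℝ)) ^ 2 * (1 + 12 * (((d + 1 : ℕ) : ℝ)) * ((((ℓ + 1 : ℕ) : ℝ)) ^ j) ^ 2))⁻¹ *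
        (((((ℓ + 1 : ℕ) : ℝ)) ^ (j + 1)) ^ (d + 1 + 1))⁻¹ * min (i.cf ^ 2 / 2) (w₀ / ((((ℓ + 1 : ℕ) : ℝ)) ^ (j + 1)) ^ (d + 1 - 2)) := by
  have hL1 : (1 : ℝ) ≤ (((ℓ + 1 : ℕ) : ℝ)) := by exact_mod_cast Nat.succ_le_succ (Nat.zero_le ℓ)
  have hd' : (0 : ℝ) < (((d + 1 : ℕ) : ℝ)) := by exact_mod_cast Nat.succ_pos d
  have hpj : (((ℓ + 1 : ℕ) : ℝ)) ^ j ≤ (((ℓ + 1 : ℕ) : ℝ)) ^ j' := pow_le_pow_right₀ hL1 hjj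
  have hpj1 : (((ℓ + 1 : ℕ) : ℝ)) ^ (j + 1) ≤ (((ℓ + 1 : ℕ) : ℝ)) ^ (j' + 1) := pow_le_pow_right₀ hL1 (by omega)
  have hpos1 : (0 : ℝ) < (((ℓ + 1 : ℕ) : ℝ)) ^ (j + 1) := by positivity
  have hA : 12 * (((d + 1 : ℕ) : ℝ)) ^ 2 * (1 + 12 * (((d + 1 : ℕ) : ℝ)) * ((((ℓ + 1 : ℕ) : ℝ)) ^ j) ^ 2) ≤
      12 * (((d + 1 : ℕ) : ℝ)) ^ 2 * (1 + 12 * (((d + 1 : ℕ) : ℝ)) * ((((ℓ + 1 : ℕ) : ℝ)) ^ j') ^ 2) := by gcongr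
  have hB : ((((ℓ + 1 : ℕ) : ℝ)) ^ (j + 1)) ^ (d + 1 + 1) ≤ ((((ℓ + 1 : ℕ) : ℝ)) ^ (j' + 1)) ^ (d + 1 + 1) := by gcongr
  have hC : ((((ℓ + 1 : ℕ) : ℝ)) ^ (j + 1)) ^ (d + 1 - 2) ≤ ((((ℓ + 1 : ℕ) : ℝ)) ^ (j' + 1)) ^ (d + 1 - 2) := by gcongr
  have hApos : 0 < 12 * (((d + 1 : ℕ) : ℝ)) ^ 2 * (1 + 12 * (((d + 1 : ℕ) : ℝ)) * ((((ℓ + 1 : ℕ) : ℝ)) ^ j) ^ 2) := by positivity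
  have hBpos : 0 < ((((ℓ + 1 : ℕ) : ℝ)) ^ (j + 1)) ^ (d + 1 + 1) := by positivity
  have hCpos : 0 < ((((ℓ + 1 : ℕ) : ℝ)) ^ (j + 1)) ^ (d + 1 - 2) := by positivity
  have hmin : min (i.cf ^ 2 / 2) (w₀ / ((((ℓ + 1 : ℕ) : ℝ)) ^ (j' + 1)) ^ (d + 1 - 2)) ≤
      min (i.cf ^ 2 / 2) (w₀ / ((((ℓ + 1 : ℕ) : ℝ)) ^ (j + 1)) ^ (d + 1 - 2)) :=
    min_le_min_left _ (div_le_div_of_nonneg_left hw₀ hCpos hC)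
  have hmin0 : 0 ≤ min (i.cf ^ 2 / 2) (w₀ / ((((ℓ + 1 : ℕ) : ℝ)) ^ (j' + 1)) ^ (d + 1 - 2)) :=
    le_min (by positivity) (div_nonneg hw₀ (by positivity))
  exact mul_le_mul (mul_le_mul (inv_anti₀ hApos hA) (inv_anti₀ hBpos hB) (inv_nonneg.2 (hBpos.trans_le hB).le)
    (inv_nonneg.2 hApos.le)) hmin hmin0 (mul_nonneg (inv_nonneg.2 hApos.le) (inv_nonneg.2 hBpos.le))

/-- the two-level centre number `γ₂(κ₂(j), π)` is ANTITONE in the level `j`. [cite: Balaban1985BackgroundPropagators, Thm 3.11 proof p.416; Balaban1984PropagatorsII, Lemma 2.4 (2.128) p.245; folklore] -/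
theorem gamma_twoLevel_antitone (i : KIdx d ℓ hd hL b₀ b₁) {w₀ : ℝ} (hw₀ : 0 < w₀) {j j' : ℕ} (hjj : j ≤ j') :
    (2 / ((12 * (((d + 1 : ℕ) : ℝ)) ^ 2 * (1 + 12 * (((d + 1 : ℕ) : ℝ)) * ((((ℓ + 1 : ℕ) : ℝ)) ^ j') ^ 2))⁻¹ *
            (((((ℓ + 1 : ℕ) : ℝ)) ^ (j' + 1)) ^ (d + 1 + 1))⁻¹ * min (i.cf ^ 2 / 2) (w₀ / ((((ℓ + 1 : ℕ) : ℝ)) ^ (j' + 1)) ^ (d + 1 - 2))) +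
        4 / (8 * i.cf ^ 2 / ((((ℓ + 1 : ℕ) : ℝ)) ^ i.k) ^ 2) *
          (1 + 4 * ((d + 1 : ℕ) : ℝ) * i.cf ^ 2 /
            ((12 * (((d + 1 : ℕ) : ℝ)) ^ 2 * (1 + 12 * (((d + 1 : ℕ) : ℝ)) * ((((ℓ + 1 : ℕ) : ℝ)) ^ j') ^ 2))⁻¹ *
              (((((ℓ + 1 : ℕ) : ℝ)) ^ (j' + 1)) ^ (d + 1 + 1))⁻¹ * min (i.cf ^ 2 / 2) (w₀ / ((((ℓ + 1 : ℕ) : ℝ)) ^ (j' + 1)) ^ (d + 1 - 2)))))⁻¹ ≤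
      (2 / ((12 * (((d + 1 : ℕ) : ℝ)) ^ 2 * (1 + 12 * (((d + 1 : ℕ) : ℝ)) * ((((ℓ + 1 : ℕ) : ℝ)) ^ j) ^ 2))⁻¹ *
            (((((ℓ + 1 : ℕ) : ℝ)) ^ (j + 1)) ^ (d + 1 + 1))⁻¹ * min (i.cf ^ 2 / 2) (w₀ / ((((ℓ + 1 : ℕ) : ℝ)) ^ (j + 1)) ^ (d + 1 - 2))) +
        4 / (8 * i.cf ^ 2 / ((((ℓ + 1 : ℕ) : ℝ)) ^ i.k) ^ 2) *
          (1 + 4 * ((d + 1 : ℕ) : ℝ) * i.cf ^ 2 /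
            ((12 * (((d + 1 : ℕ) : ℝ)) ^ 2 * (1 + 12 * (((d + 1 : ℕ) : ℝ)) * ((((ℓ + 1 : ℕ) : ℝ)) ^ j) ^ 2))⁻¹ *
              (((((ℓ + 1 : ℕ) : ℝ)) ^ (j + 1)) ^ (d + 1 + 1))⁻¹ * min (i.cf ^ 2 / 2) (w₀ / ((((ℓ + 1 : ℕ) : ℝ)) ^ (j + 1)) ^ (d + 1 - 2)))))⁻¹ := by
  have hκ := kappa_twoLevel_antitone i hw₀.le hjj
  have hκ' := local_lemma24_twoLevel_const_pos i j' hw₀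
  have hπ : 0 < 8 * i.cf ^ 2 / ((((ℓ + 1 : ℕ) : ℝ)) ^ i.k) ^ 2 := by
    have := sq_pos_iff.mpr i.hcf
    have hL : (0 : ℝ) < (((ℓ + 1 : ℕ) : ℝ)) := by exact_mod_cast Nat.succ_pos ℓ
    positivity
  have hd' : (0 : ℝ) ≤ 4 * ((d + 1 : ℕ) : ℝ) * i.cf ^ 2 := by positivity
  refine inv_anti₀ (by positivity) ?_
  gcongr

/-- ★★★ **A CUBE-UNIFORM CENTRE NUMBER PER MEMBER** — as `coer_trIP_padDeltaALocY_one_cubeDomY_of_twoLevel_of_lev`, with the constant read at the TOP level window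
`j := k − 1`: since `γ₂` is antitone in `j` (`gamma_twoLevel_antitone`), **`min 1 γ₂(k−1) · ⟨Ψ,Ψ⟩₁ ≤ ⟨Ψ, padDeltaALocY x.toKIdx parSymY parBY (cubeDomY x c) (cutMulY χP) (cutMulY χ) 1 Ψ⟩₁`**
for EVERY cube `□̃(c)` whose levels lie in SOME window `{j, j+1}`, `j + 1 ≤ k` — one `m_□(d, L, k, c_f, b₀)` for all the cubes of a member (the `hsmall` radius inequality of the
local road then reads the same for every cube). [cite: Balaban1985BackgroundPropagators, Thm 3.11 proof p.416, Cor. 3.6 p.408; Balaban1984PropagatorsII, (2.89) p.239, Lemma 2.4 (2.128) p.245, (2.2)–(2.4) p.224] -/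
theorem coer_trIP_padDeltaALocY_one_cubeDomY_of_twoLevel_unif (x : MemberY d ℓ hd hL b₀ b₁ Mstar) (c : ↥(cubes x.toKIdx.D.toDomains))
    (hd2 : 2 ≤ d + 1) {j : ℕ} (hjk : j + 1 ≤ x.toKIdx.k)
    (h2 : ∀ z ∈ cubeDomY x c, x.toKIdx.D.lev z.1 = j ∨ x.toKIdx.D.lev z.1 = j + 1)
    (hNbr2 : ∀ Y₀ Y₁ Y₂ : Site (PV d ℓ x.m x.K hd hL) (j + 1),
      (∃ y : Site (PV d ℓ x.m x.K hd hL) 0, iterBlockOf (j + 1) y = Y₀ ∧ chartY x.toKIdx y ∈ cubeDomY x c) →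
      (Y₁ = Y₀ ∨ ∃ μ, Y₁ = Y₀.shift μ ∨ Y₀ = Y₁.shift μ) → (Y₂ = Y₁ ∨ ∃ μ, Y₂ = Y₁.shift μ ∨ Y₁ = Y₂.shift μ) →
      ∀ y : Site (PV d ℓ x.m x.K hd hL) 0, iterBlockOf (j + 1) y = Y₂ → x.toKIdx.D.lev (toBox x.toKIdx.hN y : Fin (d + 1) → ℤ) ≤ j + 1)
    (hmargS : ∀ y : Site (PV d ℓ x.m x.K hd hL) j, (domT x.toKIdx.hN x.toKIdx.D x.toKIdx.hk).LamSite j y →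
      (∃ y' ∈ iterBlock j y, chartY x.toKIdx y' ∈ cubeDomY x c) →
      ∀ μ, (ℓ + 1) ^ (j + 1) ≤ (y μ).val * (ℓ + 1) ^ j ∧ (y μ).val * (ℓ + 1) ^ j + (ℓ + 1) ^ j + (ℓ + 1) ^ (j + 1) ≤ (PV d ℓ x.m x.K hd hL).sitesPerDir 0)
    (hmargT : ∀ Y : Site (PV d ℓ x.m x.K hd hL) (j + 1), (domT x.toKIdx.hN x.toKIdx.D x.toKIdx.hk).LamSite (j + 1) Y →
      (∃ Y₀ : Site (PV d ℓ x.m x.K hd hL) (j + 1), (∃ y : Site (PV d ℓ x.m x.K hd hL) 0, iterBlockOf (j + 1) y = Y₀ ∧ chartY x.toKIdx y ∈ cubeDomY x c) ∧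
        (Y = Y₀ ∨ ∃ μ, Y = Y₀.shift μ ∨ Y₀ = Y.shift μ)) →
      ∀ μ, (ℓ + 1) ^ (j + 1) ≤ (Y μ).val * (ℓ + 1) ^ (j + 1) ∧ (Y μ).val * (ℓ + 1) ^ (j + 1) + 2 * (ℓ + 1) ^ (j + 1) ≤ (PV d ℓ x.m x.K hd hL).sitesPerDir 0)
    (hb₀ : 0 < b₀) {χP : BlkY x.toKIdx → ℝ} (hχP : ∀ y, χP y = 0 ∨ χP y = 1) {χ : FBondY x.toKIdx → ℝ} (hχ : ∀ b, χ b = 0 ∨ χ b = 1)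
    (hχD : ∀ b, χ b ≠ 0 → chartY x.toKIdx b.src ∈ cubeDomY x c) (Ψ : FBondY x.toKIdx → Matrix (Fin N) (Fin N) ℂ) :
    min 1 (2 / ((12 * (((d + 1 : ℕ) : ℝ)) ^ 2 * (1 + 12 * (((d + 1 : ℕ) : ℝ)) * ((((ℓ + 1 : ℕ) : ℝ)) ^ (x.toKIdx.k - 1)) ^ 2))⁻¹ *
              (((((ℓ + 1 : ℕ) : ℝ)) ^ (x.toKIdx.k - 1 + 1)) ^ (d + 1 + 1))⁻¹ *
                min (x.toKIdx.cf ^ 2 / 2) (b₀ * x.toKIdx.cf ^ 2 / ((((ℓ + 1 : ℕ) : ℝ)) ^ (x.toKIdx.k - 1 + 1)) ^ (d + 1 - 2))) +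
          4 / (8 * x.toKIdx.cf ^ 2 / ((((ℓ + 1 : ℕ) : ℝ)) ^ x.toKIdx.k) ^ 2) *
            (1 + 4 * ((d + 1 : ℕ) : ℝ) * x.toKIdx.cf ^ 2 /
              ((12 * (((d + 1 : ℕ) : ℝ)) ^ 2 * (1 + 12 * (((d + 1 : ℕ) : ℝ)) * ((((ℓ + 1 : ℕ) : ℝ)) ^ (x.toKIdx.k - 1)) ^ 2))⁻¹ *
                (((((ℓ + 1 : ℕ) : ℝ)) ^ (x.toKIdx.k - 1 + 1)) ^ (d + 1 + 1))⁻¹ *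
                  min (x.toKIdx.cf ^ 2 / 2) (b₀ * x.toKIdx.cf ^ 2 / ((((ℓ + 1 : ℕ) : ℝ)) ^ (x.toKIdx.k - 1 + 1)) ^ (d + 1 - 2)))))⁻¹ *
        trIP (fun _ => (1 : ℝ)) Ψ Ψ ≤
      trIP (fun _ => (1 : ℝ)) Ψ
        (padDeltaALocY x.toKIdx (parSymY x.toKIdx) (parBY x.toKIdx) (cubeDomY x c) (cutMulY χP) (cutMulY χ)
          (fun _ _ => 1 : CfgY (Matrix (Fin N) (Fin N) ℂ) x.toKIdx) Ψ) :=
  le_trans (mul_le_mul_of_nonneg_right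
      (min_le_min_left 1 (gamma_twoLevel_antitone x.toKIdx (mul_pos hb₀ (sq_pos_iff.mpr x.toKIdx.hcf)) (show j ≤ x.toKIdx.k - 1 by omega)))
      (trIP_self_nonneg _ (fun _ => one_pos) Ψ))
    (coer_trIP_padDeltaALocY_one_cubeDomY_of_twoLevel_of_lev x c hd2 hjk h2 hNbr2 hmargS hmargT hb₀ hχP hχ hχD Ψ)

/-- ★★★ **ROW 17's LOCAL CLAUSE ON (3.35), CUBE-UNIFORM CENTRE NUMBER**: as `posDefTr_padDeltaALocY_of_L5_of_regYP335_twoLevel`, with `hsmall` at the member's uniform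
`m_□ = min 1 γ₂(k−1)` — the same radius inequality for every cube whose levels lie in some window `{j, j+1}`, `j + 1 ≤ k`.
[cite: Balaban1985BackgroundPropagators, Thm 3.11 proof p.416, Cor. 3.6 p.408, (3.35) p.396, pp.408–410; Balaban1984PropagatorsII, (2.89) p.239, Lemma 2.4 (2.128) p.245; Balaban1988RG2Cluster, p.15] -/
theorem posDefTr_padDeltaALocY_of_L5_of_regYP335_twoLevel_unif [Nonempty (Fin N)] {G : Subgroup (Matrix (Fin N) (Fin N) ℂ)ˣ}
    (x : MemberY d ℓ hd hL b₀ b₁ Mstar) (c : ↥(cubes x.toKIdx.D.toDomains)) {χP : BlkY x.toKIdx → ℝ} (hχP : ∀ y, χP y = 0 ∨ χP y = 1)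
    {χ : FBondY x.toKIdx → ℝ} (hχ : ∀ b, χ b = 0 ∨ χ b = 1) (hχD : ∀ b, χ b ≠ 0 → boxEquiv x.toKIdx.hN b.src ∈ cubeDomY x c)
    (hd2 : 2 ≤ d + 1) {j : ℕ} (hjk : j + 1 ≤ x.toKIdx.k)
    (h2 : ∀ z ∈ cubeDomY x c, x.toKIdx.D.lev z.1 = j ∨ x.toKIdx.D.lev z.1 = j + 1)
    (hNbr2 : ∀ Y₀ Y₁ Y₂ : Site (PV d ℓ x.m x.K hd hL) (j + 1),
      (∃ y : Site (PV d ℓ x.m x.K hd hL) 0, iterBlockOf (j + 1) y = Y₀ ∧ chartY x.toKIdx y ∈ cubeDomY x c) →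
      (Y₁ = Y₀ ∨ ∃ μ, Y₁ = Y₀.shift μ ∨ Y₀ = Y₁.shift μ) → (Y₂ = Y₁ ∨ ∃ μ, Y₂ = Y₁.shift μ ∨ Y₁ = Y₂.shift μ) →
      ∀ y : Site (PV d ℓ x.m x.K hd hL) 0, iterBlockOf (j + 1) y = Y₂ → x.toKIdx.D.lev (toBox x.toKIdx.hN y : Fin (d + 1) → ℤ) ≤ j + 1)
    (hmargS : ∀ y : Site (PV d ℓ x.m x.K hd hL) j, (domT x.toKIdx.hN x.toKIdx.D x.toKIdx.hk).LamSite j y →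
      (∃ y' ∈ iterBlock j y, chartY x.toKIdx y' ∈ cubeDomY x c) →
      ∀ μ, (ℓ + 1) ^ (j + 1) ≤ (y μ).val * (ℓ + 1) ^ j ∧ (y μ).val * (ℓ + 1) ^ j + (ℓ + 1) ^ j + (ℓ + 1) ^ (j + 1) ≤ (PV d ℓ x.m x.K hd hL).sitesPerDir 0)
    (hmargT : ∀ Y : Site (PV d ℓ x.m x.K hd hL) (j + 1), (domT x.toKIdx.hN x.toKIdx.D x.toKIdx.hk).LamSite (j + 1) Y →
      (∃ Y₀ : Site (PV d ℓ x.m x.K hd hL) (j + 1), (∃ y : Site (PV d ℓ x.m x.K hd hL) 0, iterBlockOf (j + 1) y = Y₀ ∧ chartY x.toKIdx y ∈ cubeDomY x c) ∧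
        (Y = Y₀ ∨ ∃ μ, Y = Y₀.shift μ ∨ Y₀ = Y.shift μ)) →
      ∀ μ, (ℓ + 1) ^ (j + 1) ≤ (Y μ).val * (ℓ + 1) ^ (j + 1) ∧ (Y μ).val * (ℓ + 1) ^ (j + 1) + 2 * (ℓ + 1) ^ (j + 1) ≤ (PV d ℓ x.m x.K hd hL).sitesPerDir 0)
    (hb₀ : 0 < b₀)
    {cthr α₀ : ℝ} (hc : cthr ≤ 10) (hα : 0 ≤ α₀) {U : CfgV1 (PV d ℓ x.m x.K hd hL) (Matrix (Fin N) (Fin N) ℂ)}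
    (hreg : (bg9YP (Matrix (Fin N) (Fin N) ℂ) G x).Reg335 cthr α₀ U)
    {loc : FBondY x.toKIdx × (Fin N × Fin N) → UT Nf} {R R' ρ B : ℝ}
    (hA : RawEntryLetters (fun a : Fin (d + 1) → Site (PV d ℓ x.m x.K hd hL) 0 → Matrix (Fin N) (Fin N) ℂ =>
      LinearMap.toMatrix
        ((Pi.basis fun _ : FBondY x.toKIdx => Matrix.stdBasis ℂ (Fin N) (Fin N)).reindex (Equiv.sigmaEquivProd (FBondY x.toKIdx) (Fin N × Fin N)))
        ((Pi.basis fun _ : FBondY x.toKIdx => Matrix.stdBasis ℂ (Fin N) (Fin N)).reindex (Equiv.sigmaEquivProd (FBondY x.toKIdx) (Fin N × Fin N)))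
        (padDeltaALocY x.toKIdx (parSymY x.toKIdx) (parBY x.toKIdx) (cubeDomY x c) (cutMulY χP) (cutMulY χ)
          (prodCfg (1 : CfgY (Matrix (Fin N) (Fin N) ℂ) x.toKIdx) (kGeo x.toKIdx).eta a))) loc R ρ B)
    (hρ : 0 < ρ) {mF : ℕ} (hfib : ∀ y : UT Nf, (univ.filter fun k => loc k = y).card ≤ mF)
    (hR' : 0 < R') (hR'R : R' ≤ R)
    (hsmall : 2 * (B * (mF * B6.c0 1 ρ ^ ν)) * R' <
      min 1 (2 / ((12 * (((d + 1 : ℕ) : ℝ)) ^ 2 * (1 + 12 * (((d + 1 : ℕ) : ℝ)) * ((((ℓ + 1 : ℕ) : ℝ)) ^ (x.toKIdx.k - 1)) ^ 2))⁻¹ *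
                (((((ℓ + 1 : ℕ) : ℝ)) ^ (x.toKIdx.k - 1 + 1)) ^ (d + 1 + 1))⁻¹ *
                  min (x.toKIdx.cf ^ 2 / 2) (b₀ * x.toKIdx.cf ^ 2 / ((((ℓ + 1 : ℕ) : ℝ)) ^ (x.toKIdx.k - 1 + 1)) ^ (d + 1 - 2))) +
            4 / (8 * x.toKIdx.cf ^ 2 / ((((ℓ + 1 : ℕ) : ℝ)) ^ x.toKIdx.k) ^ 2) *
              (1 + 4 * ((d + 1 : ℕ) : ℝ) * x.toKIdx.cf ^ 2 /
                ((12 * (((d + 1 : ℕ) : ℝ)) ^ 2 * (1 + 12 * (((d + 1 : ℕ) : ℝ)) * ((((ℓ + 1 : ℕ) : ℝ)) ^ (x.toKIdx.k - 1)) ^ 2))⁻¹ *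
                  (((((ℓ + 1 : ℕ) : ℝ)) ^ (x.toKIdx.k - 1 + 1)) ^ (d + 1 + 1))⁻¹ *
                    min (x.toKIdx.cf ^ 2 / 2) (b₀ * x.toKIdx.cf ^ 2 / ((((ℓ + 1 : ℕ) : ℝ)) ^ (x.toKIdx.k - 1 + 1)) ^ (d + 1 - 2)))))⁻¹ * R)
    (hCr : 2 * (kGeo x.toKIdx).L ^ 4 * ((kGeo x.toKIdx).M * α₀) * (scaleLen (kGeo x.toKIdx).L (kGeo x.toKIdx).eta c.1.1)⁻¹ ≤ R') :
    PosDefTr (fun _ => (1 : ℝ)) (padDeltaALocY x.toKIdx (parSymY x.toKIdx) (parBY x.toKIdx) (cubeDomY x c) (cutMulY χP) (cutMulY χ) U) :=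
  posDefTr_padDeltaALocY_of_L5_of_regYP335 x c χP hχD hc hα hreg hA hρ hfib
    (coer_trIP_padDeltaALocY_one_cubeDomY_of_twoLevel_unif x c hd2 hjk h2 hNbr2 hmargS hmargT hb₀ hχP hχ hχD) hR' hR'R hsmall hCr


end Summit.QuantumFields.YangMills.BalabanUVNodes.N06Row17LocalCentreTwoLevelOfLev

end
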